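import Summits.CriticalPhenomena.SAWScalingLimit.Theorems.SAWDevelopingMapInteriorFlatteningLiouvilleCompactnessA
import Summits.CriticalPhenomena.SAWScalingLimit.Theorems.SAWDevelopingMapInteriorFlatteningLiouvilleCompactnessB
import Summits.CriticalPhenomena.SAWScalingLimit.Theorems.SAWDevelopingMapInteriorFlatteningLiouvilleExtraction

/-!
# S2 `stub_compactnessAtOrigin` of the line `liouville-local-limits` (crux `InteriorFlattening`,
stmt-CriticalPhenomena-8297): compactness and `120°`-covariance at the origin

Under the bulk no-fold bound `RatioAtDepth R₀ k` (`k < 1`), if the crux fails at tolerance `ε` at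
every depth, then some lattice-scale local limit `G ∈ LocalLimits` is `ε`-bad at the origin vertex
`O`, is normalised (`M_G(O) = 1`), and its rotation `G ∘ rotO` is again a local limit. Proof:

1. BAD CONFIGURATIONS AT `O` (`exists_bad_at_O`): a failure of `RatioAtDepth R ε` at a vertex `v`
   is transported to `O` by a lattice similarity (`exists_iso_apply_eq`, helper A), under which
   the observable is invariant and domains / roots / balls / frames are transported.
2. THE BAD FRAME IS THE CLOCKWISE CLASS (`frame_reduce`, `bad_frame_ACB`): the six labellings of
   the star of `O` have the same monopole, and their `ω`-combinations are unit multiples of those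
   of `(A, B, C)` (counter-clockwise: it VANISHES for the observable, DCS Lemma 1) or of
   `(A, C, B)`; so badness always sits on `(A, C, B)` — no pigeonhole is needed.
3. NON-DEGENERACY (`obsMono_ne_zero_of_bad`): `M(O) = 0` would force the bad Beltrami mode to
   vanish by the no-fold bound at `O`.
4. LOCAL BOUNDEDNESS (helper B, `harnack_edge`) of the `M(O)`-normalised fields on every edge, and
   DIAGONAL EXTRACTION (`…LiouvilleExtraction`) of a subsequence converging on every mid-edge
   (fields set to `0` off the edge set).
5. ASSEMBLY: admissibility, normalisation, badness (a closed condition) pass to the limit; the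
   ROTATED companion is the limit of the rotated configurations `(rot⁻¹ Λₙ, rot⁻¹ aₙ)`, which are
   admissible with the same monopole at `O` (`rotO = rot3 O` permutes the star of `O`).
-/

noncomputable section

open scoped BigOperators Topology
open Filter Literature.Probability.LatticeModels Literature.Probability.RandomPlanarGeometry.SAW
open Summit.CriticalPhenomena.SAWScalingLimit.Theorems.DefectDecoherence.TipMartingale
  (rot3 rot3Iso coe_rot3Iso hexCenter_rot3 rot3_self rot3_rot3_rot3)

namespace Summit.CriticalPhenomena.SAWScalingLimit.Theorems.InteriorFlattening.Liouville

namespace Compactness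

/-! ### Monotonicity of the crux matrix -/

/-- `RatioAtDepth` is monotone in the depth. -/
theorem ratioAtDepth_mono {R R' η : ℝ} (hle : R ≤ R') (h : RatioAtDepth R η) : RatioAtDepth R' η :=
  fun Λ hΛ a ha v hv hdeep w₀ w₁ w₂ h₀ h₁ h₂ h01 h12 h02 =>
    h Λ hΛ a ha v hv (deep_anti hdeep hle) w₀ w₁ w₂ h₀ h₁ h₂ h01 h12 h02

/-! ### Step 1: bad configurations, transported to the origin -/

/-- **A failure of the crux matrix at depth `R` produces a bad configuration AT THE ORIGIN**:
transport the bad vertex to `O` by a lattice similarity (observable invariant, domain still simply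
connected, root still a boundary root, `O` now `R`-deep, frame transported). -/
theorem exists_bad_at_O {R ε : ℝ} (h : ¬ RatioAtDepth R ε) :
    ∃ (Λ : Finset HexVertex) (a : Sym2 HexVertex) (w₀ w₁ w₂ : HexVertex),
      hexDomainSimplyConnected Λ ∧ a ∈ hexDomainBoundary Λ ∧ Deep Λ O R ∧
      hexGraph.Adj O w₀ ∧ hexGraph.Adj O w₁ ∧ hexGraph.Adj O w₂ ∧ w₀ ≠ w₁ ∧ w₁ ≠ w₂ ∧ w₀ ≠ w₂ ∧
      ε * ‖fieldMono (obs Λ a) O w₀ w₁ w₂‖ < ‖fieldBelt (obs Λ a) O w₀ w₁ w₂‖ := by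
  unfold RatioAtDepth at h
  push Not at h
  obtain ⟨Λ, hΛ, a, ha, v, -, hdeep, w₀, w₁, w₂, h₀, h₁, h₂, h01, h12, h02, hlt⟩ := h
  obtain ⟨σ, κ, μ, hκ, hσv, hσ⟩ := exists_iso_apply_eq v O
  have hobs : ∀ w, obs (Λ.image σ) (a.map σ) s(O, σ w) = obs Λ a s(v, w) := fun w => by
    have e : s(O, σ w) = (s(v, w)).map σ := by rw [Sym2.map_mk, hσv]
    rw [e]
    exact observable_image σ hκ hσ Λ a _ (5 / 8)
  refine ⟨Λ.image σ, a.map σ, σ w₀, σ w₁, σ w₂, simplyConnected_image σ hΛ, boundary_image σ ha,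
    ?_, ?_, ?_, ?_, σ.injective.ne h01, σ.injective.ne h12, σ.injective.ne h02, ?_⟩
  · have hb := ball_image σ hσ (Λ := Λ) (v := v) (R := R) hdeep
    rw [hσv] at hb
    exact hb
  · rw [← hσv]; exact σ.map_rel_iff.2 h₀
  · rw [← hσv]; exact σ.map_rel_iff.2 h₁
  · rw [← hσv]; exact σ.map_rel_iff.2 h₂
  · simp only [fieldMono, fieldBelt, hobs]
    exact hlt

/-! ### Step 2: the six frames at `O` -/

/-- **The six labellings of the star of `O`, reduced**: for ANY lattice field, every labelled
frame at `O` has the monopole of `(A, B, C)`, and its `ω`-combination has the norm of that of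
`(A, B, C)` (even labellings) or of `(A, C, B)` (odd labellings). -/
theorem frame_reduce (G : Sym2 HexVertex → ℂ) {w₀ w₁ w₂ : HexVertex} (h₀ : hexGraph.Adj O w₀)
    (h₁ : hexGraph.Adj O w₁) (h₂ : hexGraph.Adj O w₂) (h01 : w₀ ≠ w₁) (h12 : w₁ ≠ w₂)
    (h02 : w₀ ≠ w₂) :
    fieldMono G O w₀ w₁ w₂ = fieldMono G O nbA nbB nbC ∧
      (‖fieldBelt G O w₀ w₁ w₂‖ = ‖fieldBelt G O nbA nbB nbC‖ ∨
        ‖fieldBelt G O w₀ w₁ w₂‖ = ‖fieldBelt G O nbA nbC nbB‖) := by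
  have h3 := omega_pow_three
  have hn1 : ‖omega‖ = 1 := norm_omega
  have hn2 : ‖omega ^ 2‖ = 1 := by rw [norm_pow, norm_omega, one_pow]
  set FA := G s(O, nbA)
  set FB := G s(O, nbB)
  set FC := G s(O, nbC)
  rcases nbr_cases h₀ with rfl | rfl | rfl <;> rcases nbr_cases h₁ with rfl | rfl | rfl <;>
    rcases nbr_cases h₂ with rfl | rfl | rfl <;>
    first
    | exact absurd rfl h01
    | exact absurd rfl h12
    | exact absurd rfl h02
    | skip
  · -- (A, B, C)
    exact ⟨rfl, Or.inl rfl⟩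
  · -- (A, C, B)
    exact ⟨by simp only [fieldMono]; ring, Or.inr rfl⟩
  · -- (B, A, C)
    refine ⟨by simp only [fieldMono]; ring, Or.inr ?_⟩
    have e : fieldBelt G O nbB nbA nbC = omega * fieldBelt G O nbA nbC nbB := by
      simp only [fieldBelt]; linear_combination (-FB) * h3
    rw [e, norm_mul, hn1, one_mul]
  · -- (B, C, A)
    refine ⟨by simp only [fieldMono]; ring, Or.inl ?_⟩
    have e : fieldBelt G O nbB nbC nbA = omega ^ 2 * fieldBelt G O nbA nbB nbC := by
      simp only [fieldBelt]; linear_combination (-(FB + omega * FC)) * h3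
    rw [e, norm_mul, hn2, one_mul]
  · -- (C, A, B)
    refine ⟨by simp only [fieldMono]; ring, Or.inl ?_⟩
    have e : fieldBelt G O nbC nbA nbB = omega * fieldBelt G O nbA nbB nbC := by
      simp only [fieldBelt]; linear_combination (-FC) * h3
    rw [e, norm_mul, hn1, one_mul]
  · -- (C, B, A)
    refine ⟨by simp only [fieldMono]; ring, Or.inr ?_⟩
    have e : fieldBelt G O nbC nbB nbA = omega ^ 2 * fieldBelt G O nbA nbC nbB := by
      simp only [fieldBelt]; linear_combination (-(FC + omega * FB)) * h3
    rw [e, norm_mul, hn2, one_mul]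

/-- **`(A, B, C)` is counter-clockwise, so its `ω`-combination of the observable vanishes** at
`O ∈ Λ` for a simply connected `Λ` with a boundary root (DCS Lemma 1). -/
theorem belt_ABC_eq_zero {Λ : Finset HexVertex} {a : Sym2 HexVertex}
    (hΛ : hexDomainSimplyConnected Λ) (ha : a ∈ hexDomainBoundary Λ) (hO : O ∈ Λ) :
    fieldBelt (obs Λ a) O nbA nbB nbC = 0 := by
  obtain ⟨he, u, c₀, rfl, hc₀, hu⟩ := ha
  have huc : hexGraph.Adj u c₀ := (SimpleGraph.mem_edgeSet _).1 he
  obtain ⟨eA, eB, eC⟩ := hexStar_up (0 : Site 2)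
  simp only [zero_sub] at eB eC
  have hd₁ : hexCenter nbB - hexCenter O = triZeta ^ 2 * (hexCenter nbA - hexCenter O) := by
    rw [show hexCenter nbA - hexCenter O = (1 + triZeta) / 3 from eA]; exact eB
  have hd₂ : hexCenter nbC - hexCenter O = triZeta ^ 4 * (hexCenter nbA - hexCenter O) := by
    rw [show hexCenter nbA - hexCenter O = (1 + triZeta) / 3 from eA]; exact eC
  exact OneMouth.bel_eq_zero_of_ccw hΛ hu hc₀ huc hO
    ⟨adj_O_nbA, adj_O_nbB, adj_O_nbC, nbA_ne_nbB, nbB_ne_nbC, nbA_ne_nbC⟩ hd₁ hd₂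

/-- **Badness sits on the clockwise frame `(A, C, B)`.** -/
theorem bad_frame_ACB {Λ : Finset HexVertex} {a : Sym2 HexVertex} {ε : ℝ} (hε : 0 ≤ ε)
    (hΛ : hexDomainSimplyConnected Λ) (ha : a ∈ hexDomainBoundary Λ) (hO : O ∈ Λ)
    {w₀ w₁ w₂ : HexVertex} (h₀ : hexGraph.Adj O w₀) (h₁ : hexGraph.Adj O w₁)
    (h₂ : hexGraph.Adj O w₂) (h01 : w₀ ≠ w₁) (h12 : w₁ ≠ w₂) (h02 : w₀ ≠ w₂)
    (hbad : ε * ‖fieldMono (obs Λ a) O w₀ w₁ w₂‖ < ‖fieldBelt (obs Λ a) O w₀ w₁ w₂‖) :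
    ε * ‖obsMono Λ a‖ < ‖fieldBelt (obs Λ a) O nbA nbC nbB‖ := by
  obtain ⟨hM, hB | hB⟩ := frame_reduce (obs Λ a) h₀ h₁ h₂ h01 h12 h02
  · rw [hM, hB, belt_ABC_eq_zero hΛ ha hO, norm_zero] at hbad
    exact absurd hbad (not_lt.2 (mul_nonneg hε (norm_nonneg _)))
  · rw [hM, hB] at hbad
    exact hbad

/-! ### Step 3: non-degeneracy of the monopole at a bad origin -/

/-- **`M(O) ≠ 0` at a bad, `R₀`-deep origin**: otherwise the no-fold bound kills the bad mode. -/
theorem obsMono_ne_zero_of_bad {k R₀ ε : ℝ} (hR : RatioAtDepth R₀ k)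
    {Λ : Finset HexVertex} {a : Sym2 HexVertex} (hΛ : hexDomainSimplyConnected Λ)
    (ha : a ∈ hexDomainBoundary Λ) (hO : O ∈ Λ) (hdeep : Deep Λ O R₀)
    (hbad : ε * ‖obsMono Λ a‖ < ‖fieldBelt (obs Λ a) O nbA nbC nbB‖) : obsMono Λ a ≠ 0 := by
  intro hM
  have hb := hR Λ hΛ a ha O hO hdeep nbA nbC nbB adj_O_nbA adj_O_nbC adj_O_nbB nbA_ne_nbC
    nbB_ne_nbC.symm nbA_ne_nbB
  have hmono : fieldMono (obs Λ a) O nbA nbC nbB = obsMono Λ a := by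
    simp only [fieldMono, obsMono]; ring
  rw [hmono, hM, norm_zero, mul_zero] at hb
  rw [hM, norm_zero, mul_zero] at hbad
  linarith

/-! ### Step 5 ingredients: the rotation about `O` -/

/-- The Defs' `rotO` is `rot3 O` of `…TipMartingaleDefs`. -/
theorem rotO_eq (f : HexVertex) : rotO f = rot3 O f := by
  obtain ⟨x, j⟩ := f
  unfold rotO rot3 O
  refine Prod.ext ?_ rfl
  fin_cases j <;> ext i <;> fin_cases i <;> simp [triRot60, sub_eq_add_neg]

/-- `rotO` as a function is the automorphism `rot3Iso O`. -/
theorem rotO_eq_coe : (rotO : HexVertex → HexVertex) = ⇑(rot3Iso O) := by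
  funext f; rw [coe_rot3Iso]; exact rotO_eq f

/-- `rot3 O` fixes `O`. -/
theorem rot_O : rot3 O O = O := rot3_self O

/-- `rot3 O` maps `A ↦ B`. -/
theorem rot_nbA : rot3 O nbA = nbB := by
  rw [← rotO_eq]; unfold rotO nbA nbB
  refine Prod.ext ?_ rfl
  ext i; fin_cases i <;> simp [triRot60]

/-- `rot3 O` maps `B ↦ C`. -/
theorem rot_nbB : rot3 O nbB = nbC := by
  rw [← rotO_eq]; unfold rotO nbB nbC
  refine Prod.ext ?_ rfl
  ext i; fin_cases i <;> simp [triRot60]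

/-- `rot3 O` maps `C ↦ A`. -/
theorem rot_nbC : rot3 O nbC = nbA := by
  rw [← rotO_eq]; unfold rotO nbC nbA
  refine Prod.ext ?_ rfl
  ext i; fin_cases i <;> simp [triRot60]

/-- The inverse rotation acts on centres by the affine map `z ↦ ζ⁴ z + (1 - ζ⁴) c_O`. -/
theorem hexCenter_rot_symm (y : HexVertex) :
    hexCenter ((rot3Iso O).symm y) = triZeta ^ 4 * hexCenter y + (1 - triZeta ^ 4) * hexCenter O := by
  show hexCenter (rot3 O (rot3 O y)) = _
  rw [hexCenter_rot3, hexCenter_rot3]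
  ring

/-- `ζ⁴ ≠ 0`. -/
theorem triZeta_pow_four_ne_zero : triZeta ^ 4 ≠ 0 := by
  apply pow_ne_zero
  intro h
  have := normSq_triZeta
  rw [h, map_zero] at this
  exact zero_ne_one this

/-- **The observable of the inversely rotated configuration is the observable read through the
rotation**: `F_{ρ⁻¹Λ, ρ⁻¹a}(z) = F_{Λ,a}(ρ z)`. -/
theorem obs_image_symm (Λ : Finset HexVertex) (a z : Sym2 HexVertex) :
    obs (Λ.image (rot3Iso O).symm) (a.map (rot3Iso O).symm) z = obs Λ a (z.map (rot3Iso O)) := by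
  have e : (z.map (rot3Iso O)).map (rot3Iso O).symm = z := by
    have hid : ((rot3Iso O).symm ∘ (rot3Iso O) : HexVertex → HexVertex) = id :=
      funext fun y => (rot3Iso O).symm_apply_apply y
    rw [Sym2.map_map, hid, Sym2.map_id, id]
  conv_lhs => rw [← e]
  exact observable_image (rot3Iso O).symm triZeta_pow_four_ne_zero hexCenter_rot_symm Λ a _ _

/-- **The monopole at `O` is invariant under the inverse rotation** (the star of `O` is
permuted). -/
theorem obsMono_image_symm (Λ : Finset HexVertex) (a : Sym2 HexVertex) :
    obsMono (Λ.image (rot3Iso O).symm) (a.map (rot3Iso O).symm) = obsMono Λ a := by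
  simp only [obsMono, fieldMono, obs_image_symm, Sym2.map_mk, coe_rot3Iso, rot_O, rot_nbA,
    rot_nbB, rot_nbC]
  ring

/-- **Admissibility is invariant under the inverse rotation.** -/
theorem adm_image_symm {n : ℕ} {Λ : Finset HexVertex} {a : Sym2 HexVertex} (h : Adm n Λ a) :
    Adm n (Λ.image (rot3Iso O).symm) (a.map (rot3Iso O).symm) := by
  obtain ⟨hΛ, ha, hdeep⟩ := h
  refine ⟨simplyConnected_image _ hΛ, boundary_image _ ha, ?_⟩
  have hb := ball_image (rot3Iso O).symm hexCenter_rot_symm (Λ := Λ) (v := O) (R := (n : ℝ)) hdeep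
  have hO : (rot3Iso O).symm O = O := by
    show rot3 O (rot3 O O) = O
    rw [rot_O, rot_O]
  rw [hO] at hb
  exact hb

/-! ### Step 4–5: normalised fields and their limits -/

/-- The three edges of the star of `O` are edges of `ℍ`. -/
theorem star_mem_edgeSet :
    s(O, nbA) ∈ hexGraph.edgeSet ∧ s(O, nbB) ∈ hexGraph.edgeSet ∧ s(O, nbC) ∈ hexGraph.edgeSet :=
  ⟨(SimpleGraph.mem_edgeSet _).2 adj_O_nbA, (SimpleGraph.mem_edgeSet _).2 adj_O_nbB,
    (SimpleGraph.mem_edgeSet _).2 adj_O_nbC⟩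

end Compactness

open Compactness

/-- **S2 — compactness and covariance at the origin.** Under bulk no-fold (`RatioAtDepth R₀ k`,
`k < 1`), if the crux fails at tolerance `ε` at every depth, some local limit `G ∈ LocalLimits` is
`ε`-bad at `O` (in the clockwise frame `(A, C, B)`), normalised (`M_G(O) = 1`), and its rotation
`G ∘ rotO` is again a local limit. -/
theorem stub_compactnessAtOrigin :
    ∀ (k R₀ ε : ℝ), 0 ≤ k → k < 1 → RatioAtDepth R₀ k → 0 < ε → (∀ n : ℕ, ¬ RatioAtDepth n ε) →
      ∃ G : Sym2 HexVertex → ℂ, G ∈ LocalLimits ∧ (G ∘ Sym2.map rotO) ∈ LocalLimits ∧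
        fieldMono G O nbA nbB nbC = 1 ∧
        ∃ w₀ w₁ w₂ : HexVertex, hexGraph.Adj O w₀ ∧ hexGraph.Adj O w₁ ∧ hexGraph.Adj O w₂ ∧
          w₀ ≠ w₁ ∧ w₁ ≠ w₂ ∧ w₀ ≠ w₂ ∧
          ε * ‖fieldMono G O w₀ w₁ w₂‖ ≤ ‖fieldBelt G O w₀ w₁ w₂‖ := by
  intro k R₀ ε hk0 hk1 hR₀ hε hfail
  classical
  -- no-fold at a nonnegative depth `R₁`
  set R₁ : ℝ := max R₀ 0 with hR₁def
  have hR₁0 : 0 ≤ R₁ := le_max_right _ _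
  have hR : RatioAtDepth R₁ k := ratioAtDepth_mono (le_max_left _ _) hR₀
  -- depths
  set m : ℕ → ℕ := fun n => n + ⌈R₁⌉₊ with hmdef
  have hm_ge : ∀ n : ℕ, (n : ℝ) ≤ (m n : ℝ) := fun n => by
    simp only [hmdef]; push_cast; linarith [Nat.cast_nonneg (α := ℝ) ⌈R₁⌉₊]
  have hm_R : ∀ n : ℕ, R₁ ≤ (m n : ℝ) := fun n => by
    simp only [hmdef]; push_cast
    linarith [Nat.le_ceil R₁, Nat.cast_nonneg (α := ℝ) n]
  -- Step 1–2: bad configurations at `O`, bad on `(A, C, B)`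
  have hconf : ∀ n : ℕ, ∃ (Λ : Finset HexVertex) (a : Sym2 HexVertex),
      hexDomainSimplyConnected Λ ∧ a ∈ hexDomainBoundary Λ ∧ Deep Λ O (m n) ∧
        ε * ‖obsMono Λ a‖ < ‖fieldBelt (obs Λ a) O nbA nbC nbB‖ := by
    intro n
    obtain ⟨Λ, a, w₀, w₁, w₂, hΛ, ha, hdeep, h₀, h₁, h₂, h01, h12, h02, hlt⟩ :=
      exists_bad_at_O (hfail (m n))
    have hO : O ∈ Λ := hdeep O (by rw [dist_self]; exact Nat.cast_nonneg _)
    exact ⟨Λ, a, hΛ, ha, hdeep, bad_frame_ACB hε.le hΛ ha hO h₀ h₁ h₂ h01 h12 h02 hlt⟩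
  choose Λ a hΛ ha hdeep hbad using hconf
  have hO : ∀ n, O ∈ Λ n := fun n => hdeep n O (by rw [dist_self]; exact Nat.cast_nonneg _)
  have hdeepR : ∀ n, Deep (Λ n) O R₁ := fun n => deep_anti (hdeep n) (hm_R n)
  -- Step 3: non-degeneracy
  have hM : ∀ n, obsMono (Λ n) (a n) ≠ 0 := fun n =>
    obsMono_ne_zero_of_bad hR (hΛ n) (ha n) (hO n) (hdeepR n) (hbad n)
  have hMpos : ∀ n, 0 < ‖obsMono (Λ n) (a n)‖ := fun n => norm_pos_iff.2 (hM n)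
  -- Step 4: normalised fields, set to `0` off the edge set, are bounded edge by edge
  set H : ℕ → Sym2 HexVertex → ℂ := fun n z =>
    if z ∈ hexGraph.edgeSet then obs (Λ n) (a n) z / obsMono (Λ n) (a n) else 0 with hHdef
  have hH_edge : ∀ n z, z ∈ hexGraph.edgeSet → H n z = obs (Λ n) (a n) z / obsMono (Λ n) (a n) :=
    fun n z hz => by simp only [hHdef, if_pos hz]
  have hH_off : ∀ n z, z ∉ hexGraph.edgeSet → H n z = 0 := fun n z hz => by
    simp only [hHdef, if_neg hz]
  have hbound : ∀ z, ∃ B : ℝ, ∀ n, ‖H n z‖ ≤ B := by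
    intro z
    by_cases hz : z ∈ hexGraph.edgeSet
    · obtain ⟨C, N, hC⟩ := harnack_edge hk0 hk1 hR hR₁0 hz
      refine Extraction.exists_forall_le_of_eventually (B := C) (N := N) fun n hn => ?_
      rw [hH_edge n z hz, norm_div, div_le_iff₀ (hMpos n)]
      exact hC (Λ n) (a n) n (hΛ n) (ha n) (deep_anti (hdeep n) (hm_ge n)) hn
    · exact ⟨0, fun n => by rw [hH_off n z hz, norm_zero]⟩
  -- diagonal extraction
  obtain ⟨φ, hφ, G, hG⟩ := Extraction.exists_strictMono_tendsto H hbound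
  have hφle : ∀ j : ℕ, (j : ℝ) ≤ (φ j : ℝ) := fun j => by exact_mod_cast hφ.le_apply
  -- limits on the edge set and off it
  have hG_edge : ∀ z ∈ hexGraph.edgeSet, Tendsto
      (fun j => obs (Λ (φ j)) (a (φ j)) z / obsMono (Λ (φ j)) (a (φ j))) atTop (𝓝 (G z)) := by
    intro z hz
    have e : (fun j => obs (Λ (φ j)) (a (φ j)) z / obsMono (Λ (φ j)) (a (φ j))) =
        fun j => H (φ j) z := funext fun j => (hH_edge (φ j) z hz).symm
    rw [e]; exact hG z
  have hG_off : ∀ z, z ∉ hexGraph.edgeSet → G z = 0 := by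
    intro z hz
    have e : (fun j => H (φ j) z) = fun _ => (0 : ℂ) := funext fun j => hH_off (φ j) z hz
    have h1 := hG z
    rw [e] at h1
    exact tendsto_nhds_unique h1 tendsto_const_nhds
  obtain ⟨heA, heB, heC⟩ := star_mem_edgeSet
  -- normalisation and badness of each normalised field
  have hmono_n : ∀ n, H n s(O, nbA) + H n s(O, nbB) + H n s(O, nbC) = 1 := by
    intro n
    rw [hH_edge n _ heA, hH_edge n _ heB, hH_edge n _ heC, ← add_div, ← add_div]
    exact div_self (hM n)
  have hbad_n : ∀ n, ε * ‖H n s(O, nbA) + H n s(O, nbC) + H n s(O, nbB)‖ ≤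
      ‖H n s(O, nbA) + omega * H n s(O, nbC) + omega ^ 2 * H n s(O, nbB)‖ := by
    intro n
    have e1 : H n s(O, nbA) + H n s(O, nbC) + H n s(O, nbB) = 1 := by rw [← hmono_n n]; ring
    have e2 : H n s(O, nbA) + omega * H n s(O, nbC) + omega ^ 2 * H n s(O, nbB) =
        fieldBelt (obs (Λ n) (a n)) O nbA nbC nbB / obsMono (Λ n) (a n) := by
      rw [hH_edge n _ heA, hH_edge n _ heB, hH_edge n _ heC]
      simp only [fieldBelt]; ring
    rw [e1, e2, norm_one, mul_one, norm_div, le_div_iff₀ (hMpos n)]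
    exact (hbad n).le
  refine ⟨G, ?_, ?_, ?_, nbA, nbC, nbB, adj_O_nbA, adj_O_nbC, adj_O_nbB, nbA_ne_nbC,
    nbB_ne_nbC.symm, nbA_ne_nbB, ?_⟩
  · -- `G ∈ LocalLimits`
    refine ⟨hG_off, fun j => Λ (φ j), fun j => a (φ j), fun j => ?_, fun j => hM (φ j), hG_edge⟩
    exact ⟨hΛ _, ha _, deep_anti (hdeep (φ j)) ((hφle j).trans (hm_ge (φ j)))⟩
  · -- `G ∘ Sym2.map rotO ∈ LocalLimits`: the limit of the inversely rotated configurations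
    rw [rotO_eq_coe]
    refine ⟨fun z hz => ?_, fun j => (Λ (φ j)).image (rot3Iso O).symm,
      fun j => (a (φ j)).map (rot3Iso O).symm, fun j => ?_, fun j => ?_, fun z hz => ?_⟩
    · show G (z.map (rot3Iso O)) = 0
      exact hG_off _ fun h => hz ((SimpleGraph.Iso.map_mem_edgeSet_iff (rot3Iso O)).1 h)
    · exact adm_image_symm ⟨hΛ _, ha _, deep_anti (hdeep (φ j)) ((hφle j).trans (hm_ge (φ j)))⟩
    · rw [obsMono_image_symm]; exact hM (φ j)
    · show Tendsto (fun j => obs ((Λ (φ j)).image (rot3Iso O).symm)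
        ((a (φ j)).map (rot3Iso O).symm) z / obsMono ((Λ (φ j)).image (rot3Iso O).symm)
          ((a (φ j)).map (rot3Iso O).symm)) atTop (𝓝 (G (z.map (rot3Iso O))))
      simp only [obs_image_symm, obsMono_image_symm]
      exact hG_edge _ ((SimpleGraph.Iso.map_mem_edgeSet_iff (rot3Iso O)).2 hz)
  · -- normalisation `M_G(O) = 1`
    have hlim : Tendsto (fun j => H (φ j) s(O, nbA) + H (φ j) s(O, nbB) + H (φ j) s(O, nbC))
        atTop (𝓝 (fieldMono G O nbA nbB nbC)) :=
      ((hG _).add (hG _)).add (hG _)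
    have e : (fun j => H (φ j) s(O, nbA) + H (φ j) s(O, nbB) + H (φ j) s(O, nbC)) =
        fun _ => (1 : ℂ) := funext fun j => hmono_n (φ j)
    rw [e] at hlim
    exact tendsto_nhds_unique hlim tendsto_const_nhds
  · -- badness, a closed condition
    have hl : Tendsto (fun j => ε * ‖H (φ j) s(O, nbA) + H (φ j) s(O, nbC) + H (φ j) s(O, nbB)‖)
        atTop (𝓝 (ε * ‖fieldMono G O nbA nbC nbB‖)) :=
      (((hG _).add (hG _)).add (hG _)).norm.const_mul ε
    have hr : Tendsto
        (fun j => ‖H (φ j) s(O, nbA) + omega * H (φ j) s(O, nbC) + omega ^ 2 * H (φ j) s(O, nbB)‖)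
        atTop (𝓝 ‖fieldBelt G O nbA nbC nbB‖) :=
      (((hG _).add ((hG _).const_mul omega)).add ((hG _).const_mul (omega ^ 2))).norm
    exact le_of_tendsto_of_tendsto' hl hr fun j => hbad_n (φ j)

end Summit.CriticalPhenomena.SAWScalingLimit.Theorems.InteriorFlattening.Liouville

end
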